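import Summits.Ventures.HSemireg.WedgeHankelRecurrenceGaussQuasiOrthogonal

/-!
# Venture HSemireg — **THE CHRISTOFFEL FUNCTION AT AN ARBITRARY POINT**: for the orthogonal polynomials `q_0, …, q_n` of a positive discrete measure `(ν, w)` and the kernel polynomial
# `K_n(·, y) = Σ_{k≤n} q_k(y) q_k ∕ h_k` (`h_k = Σ_l ν_l q_k(w_l)²`): `Σ_l ν_l K_n(w_l, y)² = K_n(y, y) > 0`, `P(y)² ≤ K_n(y, y) · Σ_l ν_l P(w_l)²` for `deg P ≤ n` (Cauchy–Schwarz), so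
# `λ_n(y) := 1 ∕ K_n(y, y) = min {Σ_l ν_l P(w_l)² : deg P ≤ n, P(y) = 1}` (attained at `K_n(·, y) ∕ K_n(y, y)`); the ATOM BOUND `ν{y} · K_n(y, y) ≤ 1` for EVERY real `y`; and the weight that the
# rule through `ξ` (N295) places at `ξ` is exactly `λ_{n+1}(ξ)` — the maximal mass (Chebyshev–Markov–Stieltjes extremal property)

HONEST FRAMING. Part of the Lean index of the computation cell `pub-hsemireg` (seat p10 gen 43, Sunday typer «UNIFORM-IN-n»).  Real polynomials and finite sums only (one `Real.sqrt` inside a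
Cauchy–Schwarz step); no variety, no cohomology theory, no sheaf, no Ext group and no semiregularity map is constructed here; nothing here says that HC / HC_CM / HC_AV holds; no Literature fact
(unproved `Prop`) is declared or used.  Custodian versions as in `WedgeHankelSiegelIdeal` (1/3).
SOURCES (cited).  E. B. Christoffel, *Über die Gaußische Quadratur und eine Verallgemeinerung derselben*, J. reine angew. Math. 55 (1858) 61–82; G. Szegő, *Orthogonal Polynomials*, Thm 3.1.3
(the extremum problem `min ∫ |P|² dα` subject to `P(y) = 1`: value `1 ∕ K_n(y, y)`, minimiser `K_n(·, y) ∕ K_n(y, y)`) and (3.4.8); J. A. Shohat, Trans. AMS 42 (1937) 461–496, §3; N. I. Akhiezer,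
*The Classical Moment Problem*, Ch. I §4 and Thm 2.5.2–2.5.3 (the maximal mass at a point of a solution of the truncated moment problem is `1 ∕ K_n`); M. G. Krein, A. A. Nudel'man, *The Markov
Moment Problem*, Ch. III §2; G. Freud, *Orthogonal Polynomials* (1971), §I.4 (Christoffel functions).
PROOF TYPED HERE.  N277 `kernel_reproducing` with `P = K_n(·, y)` gives `Σ ν K² = K(y, y)`; Cauchy–Schwarz (Mathlib `Finset.sum_mul_sq_le_sq_mul_sq` on `√ν_l K(w_l, y)`, `√ν_l P(w_l)`) gives the
inequality; the atom bound is `ν{y} · P(y)² ≤ Σ ν P²` for the minimiser; the identification of the weight at `ξ` is N277 `gauss_weight_mul_kernel_diag_eq_one` (which needs exactness only in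
degree `2t`) applied to the quasi-Gauss rule of N295, and `ν{ξ} ≤ λ` is N271 `cms_atom_le_weight`.
DEDUP DISCLOSURE (`rg -n 'christoffel_function|kernelPoly_eval_self|atom_mass|eval_sq_le_kernel' Summits Literature`, 2026-09-03): N272 `exists_eq_weight_of_christoffel` ∕ `weight_mul_eval_sq_le_sum` are
the extremal property AT A NODE OF AN EXACT RULE; N277 `gauss_weight_mul_kernel_diag_eq_one` is `λ_k K_t(x_k, x_k) = 1` at the nodes; here the point `y` is ARBITRARY and no rule is needed for
(1)–(7).  NAMECHECK: the short name `christoffel_function_min` is taken in `Summits/Ventures/HodgeRepro2/T5SU11LegendreSummaryIV` (Legendre case), hence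
`christoffel_function_min_discrete` here.  The 8 names below: 0 hits tree-wide.

WHAT IS IN THE TREE.  N277 `kernel_reproducing`, `natDegree_reproducingKernel_le`, `gauss_weight_mul_kernel_diag_eq_one`; N271 `cms_atom_le_weight`; N289 `exists_orthogonal_system_lower`; N295
`exists_positive_recurrence_of_orthogonal`, `quasi_gauss_rule_through`; Mathlib `Finset.sum_mul_sq_le_sq_mul_sq`, `Real.mul_self_sqrt`, `Finset.sum_filter`, `Finset.single_le_sum`.
THIS FILE (namespace `Summit.Ventures.HSemireg.Wedge.HankelOuter` continued; CHAINED on N295 (import), N277, N271; 0 definitions — the kernel is the inline polynomial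
`Σ_{k ∈ range (n+1)} C (q_k(y) ∕ h_k) · q_k` of N277):
* §1061 `sum_mul_eval_kernelPoly_sq` (`Σ_l ν_l K_n(w_l, y)² = K_n(y, y)`), `kernelPoly_eval_self_eq` (`K_n(y, y) = Σ_k q_k(y)² ∕ h_k`), `kernelPoly_eval_self_pos` (`K_n(y, y) > 0`),
  **`eval_sq_le_kernel_mul_sum_sq`** (`P(y)² ≤ K_n(y, y) Σ_l ν_l P(w_l)²`, `deg P ≤ n`), **`christoffel_function_min_discrete`** (SZEGŐ 3.1.3: for `P(y) = 1`, `deg P ≤ n`: `1 ∕ K_n(y, y) ≤ Σ_l ν_l P(w_l)²`, and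
  the value is attained by `K_n(·, y) ∕ K_n(y, y)`), `atom_mass_le_sum_sq` (`ν{y} ≤ Σ_l ν_l P(w_l)²` whenever `P(y) = 1`), **`atom_mass_mul_kernel_le_one`** (AKHIEZER: `ν{y} · K_n(y, y) ≤ 1` for every
  real `y`, `n < N`), **`quasi_gauss_weight_at_eq_christoffel`** (for `q_{n+1}(ξ) ≠ 0`: the rule through `ξ` of N295 has weight `λ` at `ξ` with `λ · K_{n+1}(ξ, ξ) = 1` and `ν{ξ} ≤ λ` — the canonical
  representation carries the maximal mass at `ξ`).
CAVEATS.  Discrete positive measures with finitely many atoms, as throughout the chapter; `n < N` (so that `h_k > 0` for `k ≤ n`).  Nothing Ext-side.  New names only.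
-/

open Module Polynomial
open scoped Matrix Polynomial

namespace Summit.Ventures.HSemireg.Wedge.HankelOuter

/-! ## §1061. The Christoffel function `λ_n(y) = 1 ∕ K_n(y, y)` at an arbitrary point -/

/-- **`Σ_l ν_l K_n(w_l, y)² = K_n(y, y)`** (the reproducing property applied to the kernel itself). [Szegő (3.1.10); this file, §1061] -/
theorem sum_mul_eval_kernelPoly_sq {N m : ℕ} {ν w : Fin N → ℝ} {q : ℕ → ℝ[X]} (hmonic : ∀ k, k ≤ m → (q k).Monic) (hdeg : ∀ k, k ≤ m → (q k).natDegree = k)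
    (horth : ∀ k, k ≤ m → ∀ G : ℝ[X], G.natDegree < k → ∑ l, ν l * (q k * G).eval (w l) = 0) (hh : ∀ k, k ≤ m → ∑ l, ν l * ((q k).eval (w l)) ^ 2 ≠ 0)
    {n : ℕ} (hn : n ≤ m) (y : ℝ) :
    ∑ l, ν l * ((∑ k ∈ Finset.range (n + 1), C ((q k).eval y / ∑ l, ν l * ((q k).eval (w l)) ^ 2) * q k).eval (w l)) ^ 2 =
      (∑ k ∈ Finset.range (n + 1), C ((q k).eval y / ∑ l, ν l * ((q k).eval (w l)) ^ 2) * q k).eval y := by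
  have h := kernel_reproducing hmonic hdeg horth hh hn (natDegree_reproducingKernel_le (ν := ν) (w := w) (n := n) (fun k hk => hdeg k (hk.trans hn)) y) y
  rw [← h]
  exact Finset.sum_congr rfl fun l _ => by rw [eval_mul, sq]

/-- **`K_n(y, y) = Σ_{k ≤ n} q_k(y)² ∕ h_k`.** [Szegő (3.1.9); this file, §1061] -/
theorem kernelPoly_eval_self_eq {N : ℕ} (ν w : Fin N → ℝ) (q : ℕ → ℝ[X]) (n : ℕ) (y : ℝ) :
    (∑ k ∈ Finset.range (n + 1), C ((q k).eval y / ∑ l, ν l * ((q k).eval (w l)) ^ 2) * q k).eval y =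
      ∑ k ∈ Finset.range (n + 1), ((q k).eval y) ^ 2 / ∑ l, ν l * ((q k).eval (w l)) ^ 2 := by
  rw [eval_finsetSum]
  exact Finset.sum_congr rfl fun k _ => by rw [eval_mul, eval_C]; ring

/-- **`K_n(y, y) > 0`** for a positive discrete measure (`ν > 0`, `w` injective, `n < N`): the `k = 0` term is `1 ∕ Σ_l ν_l > 0` and the others are `≥ 0`. [Szegő §3.1; this file, §1061] -/
theorem kernelPoly_eval_self_pos {N n : ℕ} {ν w : Fin N → ℝ} (hν : ∀ l, 0 < ν l) (hw : Function.Injective w) (hnN : n < N) {q : ℕ → ℝ[X]} (hq0 : q 0 = 1)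
    (hmonic : ∀ k, k ≤ n → (q k).Monic) (hdeg : ∀ k, k ≤ n → (q k).natDegree = k) (y : ℝ) :
    0 < (∑ k ∈ Finset.range (n + 1), C ((q k).eval y / ∑ l, ν l * ((q k).eval (w l)) ^ 2) * q k).eval y := by
  rw [kernelPoly_eval_self_eq]
  have hh : ∀ k, k ≤ n → 0 < ∑ l, ν l * ((q k).eval (w l)) ^ 2 := fun k hk =>
    sum_mul_eval_sq_pos_of_natDegree_lt hν hw (hmonic k hk).ne_zero (by rw [hdeg k hk]; omega)
  have h0 : 0 < ((q 0).eval y) ^ 2 / ∑ l, ν l * ((q 0).eval (w l)) ^ 2 := by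
    refine div_pos ?_ (hh 0 (Nat.zero_le _))
    rw [hq0, eval_one, one_pow]; exact one_pos
  refine lt_of_lt_of_le h0 (Finset.single_le_sum (f := fun k => ((q k).eval y) ^ 2 / ∑ l, ν l * ((q k).eval (w l)) ^ 2) (fun k hk => ?_) (Finset.mem_range.2 (Nat.succ_pos n)))
  exact div_nonneg (sq_nonneg _) (hh k (Nat.lt_succ_iff.1 (Finset.mem_range.1 hk))).le

/-- **Cauchy–Schwarz with the reproducing kernel**: for `ν ≥ 0` and `deg P ≤ n ≤ m`, `P(y)² ≤ K_n(y, y) · Σ_l ν_l P(w_l)²`. [Szegő Thm 3.1.3 (proof); Freud §I.4; this file, §1061] -/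
theorem eval_sq_le_kernel_mul_sum_sq {N m : ℕ} {ν w : Fin N → ℝ} (hν : ∀ l, 0 ≤ ν l) {q : ℕ → ℝ[X]} (hmonic : ∀ k, k ≤ m → (q k).Monic)
    (hdeg : ∀ k, k ≤ m → (q k).natDegree = k) (horth : ∀ k, k ≤ m → ∀ G : ℝ[X], G.natDegree < k → ∑ l, ν l * (q k * G).eval (w l) = 0)
    (hh : ∀ k, k ≤ m → ∑ l, ν l * ((q k).eval (w l)) ^ 2 ≠ 0) {n : ℕ} (hn : n ≤ m) {P : ℝ[X]} (hP : P.natDegree ≤ n) (y : ℝ) :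
    (P.eval y) ^ 2 ≤ (∑ k ∈ Finset.range (n + 1), C ((q k).eval y / ∑ l, ν l * ((q k).eval (w l)) ^ 2) * q k).eval y * ∑ l, ν l * (P.eval (w l)) ^ 2 := by
  set K : ℝ[X] := ∑ k ∈ Finset.range (n + 1), C ((q k).eval y / ∑ l, ν l * ((q k).eval (w l)) ^ 2) * q k with hK
  -- `P(y) = Σ_l ν_l K(w_l) P(w_l) = Σ_l (√ν_l K(w_l)) (√ν_l P(w_l))`
  have hrep : P.eval y = ∑ l, (Real.sqrt (ν l) * K.eval (w l)) * (Real.sqrt (ν l) * P.eval (w l)) := by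
    rw [← kernel_reproducing hmonic hdeg horth hh hn hP y]
    refine Finset.sum_congr rfl fun l _ => ?_
    rw [eval_mul, show Real.sqrt (ν l) * K.eval (w l) * (Real.sqrt (ν l) * P.eval (w l)) = (Real.sqrt (ν l) * Real.sqrt (ν l)) * (K.eval (w l) * P.eval (w l)) by ring,
      Real.mul_self_sqrt (hν l)]
  have hcs := Finset.sum_mul_sq_le_sq_mul_sq Finset.univ (fun l => Real.sqrt (ν l) * K.eval (w l)) (fun l => Real.sqrt (ν l) * P.eval (w l))
  have h1 : ∑ l, (Real.sqrt (ν l) * K.eval (w l)) ^ 2 = K.eval y := by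
    rw [← sum_mul_eval_kernelPoly_sq hmonic hdeg horth hh hn y]
    exact Finset.sum_congr rfl fun l _ => by rw [mul_pow, Real.sq_sqrt (hν l)]
  have h2 : ∑ l, (Real.sqrt (ν l) * P.eval (w l)) ^ 2 = ∑ l, ν l * (P.eval (w l)) ^ 2 :=
    Finset.sum_congr rfl fun l _ => by rw [mul_pow, Real.sq_sqrt (hν l)]
  rw [hrep, ← h1, ← h2]
  exact hcs

/-- **SZEGŐ'S THEOREM 3.1.3 (the Christoffel function).**  For a positive discrete measure (`ν > 0`, `w` injective, `n < N`) with orthogonal polynomials `q_0 = 1, …, q_n` and any real `y`: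
every `P` with `deg P ≤ n` and `P(y) = 1` has `1 ∕ K_n(y, y) ≤ Σ_l ν_l P(w_l)²`, and the polynomial `K_n(·, y) ∕ K_n(y, y)` (degree `≤ n`, value `1` at `y`) attains the bound.
[Szegő Thm 3.1.3; Freud §I.4; Akhiezer Thm 2.5.2; this file, §1061] -/
theorem christoffel_function_min_discrete {N n : ℕ} {ν w : Fin N → ℝ} (hν : ∀ l, 0 < ν l) (hw : Function.Injective w) (hnN : n < N) {q : ℕ → ℝ[X]} (hq0 : q 0 = 1)
    (hmonic : ∀ k, k ≤ n → (q k).Monic) (hdeg : ∀ k, k ≤ n → (q k).natDegree = k)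
    (horth : ∀ k, k ≤ n → ∀ G : ℝ[X], G.natDegree < k → ∑ l, ν l * (q k * G).eval (w l) = 0) (y : ℝ) :
    (∀ P : ℝ[X], P.natDegree ≤ n → P.eval y = 1 →
      1 / (∑ k ∈ Finset.range (n + 1), C ((q k).eval y / ∑ l, ν l * ((q k).eval (w l)) ^ 2) * q k).eval y ≤ ∑ l, ν l * (P.eval (w l)) ^ 2) ∧
    ∃ P : ℝ[X], P.natDegree ≤ n ∧ P.eval y = 1 ∧
      ∑ l, ν l * (P.eval (w l)) ^ 2 = 1 / (∑ k ∈ Finset.range (n + 1), C ((q k).eval y / ∑ l, ν l * ((q k).eval (w l)) ^ 2) * q k).eval y := by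
  set K : ℝ[X] := ∑ k ∈ Finset.range (n + 1), C ((q k).eval y / ∑ l, ν l * ((q k).eval (w l)) ^ 2) * q k with hK
  have hh : ∀ k, k ≤ n → ∑ l, ν l * ((q k).eval (w l)) ^ 2 ≠ 0 := fun k hk =>
    (sum_mul_eval_sq_pos_of_natDegree_lt hν hw (hmonic k hk).ne_zero (by rw [hdeg k hk]; omega)).ne'
  have hKpos : 0 < K.eval y := kernelPoly_eval_self_pos hν hw hnN hq0 hmonic hdeg y
  refine ⟨fun P hP hPy => ?_, ⟨C (1 / K.eval y) * K, ?_, ?_, ?_⟩⟩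
  · have h := eval_sq_le_kernel_mul_sum_sq (fun l => (hν l).le) hmonic hdeg horth hh le_rfl hP y
    rw [hPy, one_pow] at h
    rw [div_le_iff₀ hKpos, mul_comm]
    exact h
  · exact (natDegree_C_mul_le _ _).trans (natDegree_reproducingKernel_le (ν := ν) (w := w) hdeg y)
  · rw [eval_mul, eval_C, one_div, inv_mul_cancel₀ hKpos.ne']
  · have hsq := sum_mul_eval_kernelPoly_sq hmonic hdeg horth hh le_rfl y
    rw [← hK] at hsq
    have hterm : ∀ l, ν l * ((C (1 / K.eval y) * K).eval (w l)) ^ 2 = (1 / K.eval y) ^ 2 * (ν l * (K.eval (w l)) ^ 2) := fun l => by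
      rw [eval_mul, eval_C]; ring
    rw [Finset.sum_congr rfl fun l _ => hterm l, ← Finset.mul_sum, hsq, pow_two, mul_assoc, one_div_mul_cancel hKpos.ne', mul_one]

/-- **An atom is bounded by every admissible quadratic sum**: for `ν ≥ 0` and `P(y) = 1`, `ν{y} = Σ_{l : w_l = y} ν_l ≤ Σ_l ν_l P(w_l)²`. [mechanism; Akhiezer II §5; this file, §1061] -/
theorem atom_mass_le_sum_sq {N : ℕ} {ν w : Fin N → ℝ} (hν : ∀ l, 0 ≤ ν l) {P : ℝ[X]} {y : ℝ} (hPy : P.eval y = 1) :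
    ∑ l ∈ Finset.univ.filter (fun l => w l = y), ν l ≤ ∑ l, ν l * (P.eval (w l)) ^ 2 := by
  calc ∑ l ∈ Finset.univ.filter (fun l => w l = y), ν l = ∑ l ∈ Finset.univ.filter (fun l => w l = y), ν l * (P.eval (w l)) ^ 2 :=
        Finset.sum_congr rfl fun l hl => by rw [(Finset.mem_filter.1 hl).2, hPy, one_pow, mul_one]
    _ ≤ ∑ l, ν l * (P.eval (w l)) ^ 2 :=
        Finset.sum_le_sum_of_subset_of_nonneg (Finset.filter_subset _ _) fun l _ _ => mul_nonneg (hν l) (sq_nonneg _)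

/-- **AKHIEZER'S ATOM BOUND: `ν{y} · K_n(y, y) ≤ 1`** for every real `y` and every `n < N`: no point carries more mass than the Christoffel function `λ_n(y) = 1 ∕ K_n(y, y)`.
[Akhiezer Thm 2.5.3; Krein–Nudel'man III §2; Szegő Thm 3.1.3; this file, §1061] -/
theorem atom_mass_mul_kernel_le_one {N n : ℕ} {ν w : Fin N → ℝ} (hν : ∀ l, 0 < ν l) (hw : Function.Injective w) (hnN : n < N) {q : ℕ → ℝ[X]} (hq0 : q 0 = 1)
    (hmonic : ∀ k, k ≤ n → (q k).Monic) (hdeg : ∀ k, k ≤ n → (q k).natDegree = k)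
    (horth : ∀ k, k ≤ n → ∀ G : ℝ[X], G.natDegree < k → ∑ l, ν l * (q k * G).eval (w l) = 0) (y : ℝ) :
    (∑ l ∈ Finset.univ.filter (fun l => w l = y), ν l) * (∑ k ∈ Finset.range (n + 1), C ((q k).eval y / ∑ l, ν l * ((q k).eval (w l)) ^ 2) * q k).eval y ≤ 1 := by
  have hKpos := kernelPoly_eval_self_pos hν hw hnN hq0 hmonic hdeg y
  obtain ⟨-, P, -, hPy, hval⟩ := christoffel_function_min_discrete hν hw hnN hq0 hmonic hdeg horth y
  have h := atom_mass_le_sum_sq (w := w) (fun l => (hν l).le) hPy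
  rw [hval] at h
  rwa [← le_div_iff₀ hKpos]

/-- **THE RULE THROUGH `ξ` CARRIES THE MAXIMAL MASS `λ_{n+1}(ξ) = 1 ∕ K_{n+1}(ξ, ξ)` AT `ξ`.**  For a positive discrete measure (`ν > 0`, `w` injective, `n + 2 < N`) with orthogonal polynomials
`q_0, …, q_{n+2}` and a real `ξ` with `q_{n+1}(ξ) ≠ 0`, there is a positive rule `(λ, y)` with `n + 2` nodes `y_0 < ⋯ < y_{n+1}`, `y_i = ξ`, exact in degree `≤ 2n + 2`, whose weight at `ξ`
satisfies `λ_i · K_{n+1}(ξ, ξ) = 1` and `ν{ξ} ≤ λ_i`. [Shohat 1937 §3; Akhiezer Thm 2.5.2–2.5.3; Szegő (3.4.8); this file, §1061] -/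
theorem quasi_gauss_weight_at_eq_christoffel {N n : ℕ} {ν w : Fin N → ℝ} (hν : ∀ l, 0 < ν l) (hw : Function.Injective w) (hnN : n + 2 < N) {q : ℕ → ℝ[X]} (hq0 : q 0 = 1)
    (hmonic : ∀ k, k ≤ n + 2 → (q k).Monic) (hdeg : ∀ k, k ≤ n + 2 → (q k).natDegree = k)
    (horth : ∀ k, k ≤ n + 2 → ∀ G : ℝ[X], G.natDegree < k → ∑ l, ν l * (q k * G).eval (w l) = 0) {ξ : ℝ} (hξ : (q (n + 1)).eval ξ ≠ 0) :
    ∃ (y μ : Fin (n + 2) → ℝ) (i : Fin (n + 2)), StrictMono y ∧ y i = ξ ∧ (∀ k, 0 < μ k) ∧ (∀ p, p ≤ 2 * n + 2 → ∑ k, μ k * y k ^ p = ∑ l, ν l * w l ^ p) ∧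
      μ i * ∑ j ∈ Finset.range (n + 2), ((q j).eval ξ) ^ 2 / ∑ l, ν l * ((q j).eval (w l)) ^ 2 = 1 ∧
      ∑ l ∈ Finset.univ.filter (fun l => w l = ξ), ν l ≤ μ i := by
  obtain ⟨a, b, Q, hQ0, hQ1, hQrec, hb, hagree⟩ := exists_positive_recurrence_of_orthogonal hν hw hnN hq0 hmonic hdeg horth
  have horthQ : ∀ k, k ≤ n + 2 → ∀ G : ℝ[X], G.natDegree < k → ∑ l, ν l * (Q k * G).eval (w l) = 0 := fun k hk G hG => by
    rw [hagree k hk]; exact horth k hk G hG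
  have hξQ : (Q (n + 1)).eval ξ ≠ 0 := by rw [hagree (n + 1) (by omega)]; exact hξ
  obtain ⟨y, μ, i, hy, hyi, hpos, hmom⟩ := quasi_gauss_rule_through hν hw (by omega) hQ0 hQ1 hQrec hb (horthQ (n + 1) (by omega)) (horthQ (n + 2) le_rfl) hξQ
  have hh : ∀ k, k ≤ n + 1 → ∑ l, ν l * ((q k).eval (w l)) ^ 2 ≠ 0 := fun k hk =>
    (sum_mul_eval_sq_pos_of_natDegree_lt hν hw (hmonic k (by omega)).ne_zero (by rw [hdeg k (by omega)]; omega)).ne'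
  have hker := gauss_weight_mul_kernel_diag_eq_one (t := n + 1) (fun k hk => hmonic k (by omega)) (fun k hk => hdeg k (by omega)) (fun k hk => horth k (by omega)) hh hy.injective hmom i
  rw [hyi] at hker
  have hatom := cms_atom_le_weight hy (fun l => (hν l).le) (fun p hp => hmom p (by omega)) i
  rw [hyi] at hatom
  exact ⟨y, μ, i, hy, hyi, hpos, hmom, hker, hatom⟩

end Summit.Ventures.HSemireg.Wedge.HankelOuter
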